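import Literature.Computability.FineGrained.ConjecturesAPSPProofs
import HarnessLib

/-!
# The randomised APSP hypothesis `APSPConjectureRand`: status, and the trivial regime `ε > 1` (proved)

Companion to `Literature.Computability.FineGrained.Conjectures` (fine-grained.S11) for the named
statement `Literature.Computability.FineGrained.APSPConjectureRand`
(`∀ ε > 0, ∃ c, ¬ (APSP c).RandInTimeO (n ↦ n^{3-ε})`: for every `ε > 0`, for large enough `c`,
no randomised word-RAM algorithm with success probability `≥ 2/3` solves APSP on `n`-node graphs
with weights in `{-n^c, …, n^c}` in time `O(n^{3-ε})`); the deterministic companion is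
`Literature.Computability.FineGrained.ConjecturesAPSPProofs`, whose hard instances (unit-weight
stars) and counting lemmas are reused here.

## Status of `APSPConjectureRand` (provefact audit): an open hypothesis, no discharge

`APSPConjectureRand` has **no discharge** `APSPConjectureRand_holds`. It is the randomised
wording of the APSP hypothesis, printed everywhere as a *hypothesis/conjecture* and proved
nowhere. Sources, as printed:

* V. Vassilevska Williams, *On some fine-grained questions in algorithms and complexity*,
  Proc. ICM 2018, Vol. 4, §4, **Hypothesis 4** (quoted in the docstring of `APSPConjectureRand`:
  "no randomized algorithm can solve APSP in `O(n^{3-ε})` time for `ε > 0` … for large enough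
  `c`"); it is one of the numbered *Hypotheses* of the survey, on a par with SETH, the OV and the
  3SUM hypotheses (§3). [cite: VassilevskaWilliamsICM2018, §4 Hypothesis 4]
* V. Vassilevska Williams, *Hardness of easy problems: basing hardness on popular conjectures
  such as the Strong Exponential Time Hypothesis*, IPEC 2015 (LIPIcs 43), §2.2, p. 20,
  **Conjecture 2 (No truly subcubic APSP)**, verbatim: "There is a constant `c`, such that in the
  Word RAM model with `O(log n)` bit words, any algorithm requires `n^{3-o(1)}` time in
  expectation to compute the distances between every pair of vertices in an `n` node graph with
  edge weights in `{1, …, n^c}`." ("in expectation": the randomised form), introduced by "no truly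
  subcubic time (`O(n^{3-ε})` for `ε > 0`) algorithm for APSP is known. This led to the following
  conjecture assumed in many papers". Loc. cit., §1, p. 18: "Unconditional lower bounds seem very
  difficult to obtain – it is not even known whether SAT can be solved in linear time."
  [cite: VassilevskaWilliamsIPEC2015, §2.2 Conjecture 2]
* K. Bringmann, *Fine-grained complexity theory (tutorial)*, STACS 2019 (LIPIcs 126), §2 (Key
  Conjectures), All Pairs Shortest Path: "It is conjectured that All Pairs Shortest Path has no
  `O(n^{3-δ})`-time algorithm for any `δ > 0`." [cite: BringmannSTACS2019, §2]
* V. Vassilevska Williams, R. Williams, J. ACM 65 (2018), Art. 27, §1 states the hypothesis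
  conditionally and proves only equivalences (Thm. 1.1); see the deterministic companion
  `…ConjecturesAPSPProofs` for the page quotes. [cite: VassilevskaWilliamsWilliams2018, §1]

So neither direction is available: a truly subcubic randomised APSP algorithm would refute a
central hypothesis of the field, and a proof of `APSPConjectureRand` at any `0 < ε ≤ 1` would
be a superlinear unconditional time lower bound (in the input length `N = n² + 1`: time
`N^{(3-ε)/2}`, e.g. `N^{1.25}`) for an explicit polynomial-time function on the unit-cost word
RAM, against randomised machines, of which none is known. `APSPConjectureRand` is the formally
*stronger* of the two vendored APSP hypotheses (`apspConjecture_of_apspConjectureRand_holds` in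
`Conjectures`); it stays a named hypothesis (`def … : Prop`), used as `(h : APSPConjectureRand)`.

## What this file proves

* `APSP_randInTimeO_anti`, `apspConjectureRand_iff_eventually`: randomised `O(t)` algorithms for
  `APSP c'` are algorithms for `APSP c`, `c ≤ c'`, so the printed "for large enough `c`" and the
  vendored `∃ c` agree (the randomised counterpart of `apspConjecture_iff_eventually`);
* `successProb_star_eq_zero`: on the unit-weight star with `m + 1` vertices
  (`starInst`, deterministic companion) every run that outputs the distance matrix changes `m²`
  memory cells (`mul_self_le_of_haltsWithin_star`), whatever the coin words; so within `t < m²`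
  steps the success probability of *any* program is `0`;
* `APSP_not_randInTimeO_rpow_of_lt_two`: hence for every `c` and real `s < 2`, `APSP c` has no
  randomised `O(n^s)`-time algorithm (the budget `⌊C n^s + C⌋₊` is eventually `< m²`,
  `exists_floor_lt_mul_self`), i.e. (`APSP_not_randInTimeO_of_one_lt`,
  `apspConjectureRand_restricted_one_lt`) the instances `ε > 1` of `APSPConjectureRand` hold
  outright and the hypothesis is equivalent to its restriction to `0 < ε ≤ 1`
  (`apspConjectureRand_iff_le_one`) — the genuinely open content;
* `not_randTrulySubTime_iff`, `apspConjectureRand_of_not_randTrulySubTime`: the link with the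
  `RandTrulySubTime` vocabulary of `Literature.Computability.Cryptography.FGComplexity`.

The regime `0 < ε ≤ 1` is untouched and open.

## References

* V. Vassilevska Williams, Proc. ICM 2018, Vol. 4, 3447–3487, §4 Hypothesis 4.
  doi:10.1142/9789813272880_0188
* V. Vassilevska Williams, IPEC 2015, LIPIcs 43, 17–29, §2.2 Conjecture 2.
  doi:10.4230/LIPIcs.IPEC.2015.17
* K. Bringmann, STACS 2019, LIPIcs 126, 4:1–4:7, §2.
* V. Vassilevska Williams, R. R. Williams, J. ACM 65 (2018), Art. 27, §1. doi:10.1145/3186893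
* Output-size lower bounds (a machine writing one word per step needs `Ω(output length)` steps,
  for every coin sequence): folklore.
-/

namespace Literature.Computability.FineGrained

open Filter Cryptography Cryptography.WordRAM

/-! ## "For large enough `c`" versus `∃ c` -/

/-- A randomised `O(t)`-time algorithm for `APSP c'` is one for `APSP c` when `c ≤ c'` (the
instance sets are nested, `APSP_instances_mono`); hence non-existence of randomised algorithms is
monotone in the weight exponent. [folklore] -/
theorem APSP_randInTimeO_anti {c c' : ℕ} (hcc' : c ≤ c') {t : ℕ → ℝ}
    (h : (APSP c').RandInTimeO t) : (APSP c).RandInTimeO t :=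
  randInTimeO_restrict_anti (APSP_instances_mono hcc') h

/-- The randomised APSP hypothesis `APSPConjectureRand` (rendered with `∃ c`) is equivalent to
its printed "for all large enough `c`" wording (VVW ICM 2018, §4, Hypothesis 4).
[cite: VassilevskaWilliamsICM2018, §4 Hypothesis 4] -/
theorem apspConjectureRand_iff_eventually :
    APSPConjectureRand ↔
      ∀ ε : ℝ, 0 < ε → ∀ᶠ c in atTop, ¬ (APSP c).RandInTimeO fun n => (n : ℝ) ^ (3 - ε) := by
  refine forall₂_congr fun ε _ => ⟨fun ⟨c, hc⟩ => ?_, fun h => h.exists⟩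
  exact eventually_atTop.2 ⟨c, fun c' hcc' h' => hc (APSP_randInTimeO_anti hcc' h')⟩

/-! ## The trivial regime: randomised algorithms also need `Ω(n²)` steps -/

/-- **No coin sequence helps below the output size.** On the unit-weight star with `m + 1`
vertices, within `t < m²` steps the success probability of every word-RAM program (any word
size) is `0`: a run that outputs the distance matrix changes `m²` cells
(`mul_self_le_of_haltsWithin_star`), for every coin stream. [folklore] -/
theorem successProb_star_eq_zero (M : Program) (c m w : ℕ) {t : ℕ} (ht : t < m * m) :
    successProb M w noOracle ((APSP c).encode (starInst c m)) ((APSP c).Good (starInst c m)) t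
      = 0 := by
  classical
  have key : ∀ ρ : Fin t → Fin (2 ^ w), ¬ ∃ out ∈ (APSP c).Good (starInst c m),
      OutputsWithin M w noOracle (coinStream ρ) ((APSP c).encode (starInst c m)) out t := by
    rintro ρ ⟨out, hout, hrun⟩
    have hout' : out = encodeMatrixWithTop (shortestDist (starWeights m)) := by
      simpa [starInst] using hout
    subst hout'
    rw [outputsWithin_iff_exists_haltsWithin] at hrun
    obtain ⟨cfg, hhalt, hro⟩ := hrun
    exact absurd (mul_self_le_of_haltsWithin_star hhalt hro) (not_le.2 ht)
  unfold successProb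
  rw [Finset.filter_false_of_mem (fun ρ _ => key ρ)]
  simp

/-- **APSP needs `Ω(n²)` time, also for randomised algorithms (output size).** For every weight
exponent `c` and every real `s < 2`, `APSP c` has no randomised word-RAM algorithm running in
time `O(n^s)` with success probability `≥ 2/3`: on the star with `n = m + 1` vertices and
`⌊C n^s + C⌋₊ < m²` (`exists_floor_lt_mul_self`) the success probability is `0`
(`successProb_star_eq_zero`). [folklore] -/
theorem APSP_not_randInTimeO_rpow_of_lt_two (c : ℕ) {s : ℝ} (hs : s < 2) :
    ¬ (APSP c).RandInTimeO fun n => (n : ℝ) ^ s := by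
  rintro ⟨C, M, k, -, hM⟩
  obtain ⟨m, hm⟩ := exists_floor_lt_mul_self C hs
  have h := hM (starInst c m)
  have h0 := successProb_star_eq_zero M c m (k * (APSP c).width (starInst c m)) hm
  change (2 / 3 : ℝ) ≤ successProb M (k * (APSP c).width (starInst c m)) noOracle
    ((APSP c).encode (starInst c m)) ((APSP c).Good (starInst c m))
    ⌊C * ((m + 1 : ℕ) : ℝ) ^ s + C⌋₊ at h
  rw [h0] at h
  norm_num at h

/-- **The `ε > 1` instances of the randomised APSP hypothesis hold, for every weight exponent.**
For `ε > 1` there is no randomised `O(n^{3-ε})`-time algorithm for `APSP c`, whatever `c`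
(output size). The instances `0 < ε ≤ 1` are the open APSP hypothesis
(VVW ICM 2018, §4, Hypothesis 4) and are not asserted anywhere in this library. [folklore] -/
theorem APSP_not_randInTimeO_of_one_lt (c : ℕ) {ε : ℝ} (hε : 1 < ε) :
    ¬ (APSP c).RandInTimeO fun n => (n : ℝ) ^ (3 - ε) :=
  APSP_not_randInTimeO_rpow_of_lt_two c (by linarith)

/-- The randomised APSP hypothesis restricted to `ε > 1` holds (with `c = 0` as witness for
every such `ε`); the full statement `APSPConjectureRand` (all `ε > 0`) is open. [folklore] -/
theorem apspConjectureRand_restricted_one_lt :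
    ∀ ε : ℝ, 1 < ε → ∃ c : ℕ, ¬ (APSP c).RandInTimeO fun n => (n : ℝ) ^ (3 - ε) :=
  fun _ hε => ⟨0, APSP_not_randInTimeO_of_one_lt 0 hε⟩

/-- **What remains open is exactly the regime `0 < ε ≤ 1`:** `APSPConjectureRand`
(VVW ICM 2018, §4, Hypothesis 4) is equivalent to its restriction to `0 < ε ≤ 1`, the instances
`ε > 1` being theorems (`apspConjectureRand_restricted_one_lt`). [folklore] -/
theorem apspConjectureRand_iff_le_one :
    APSPConjectureRand ↔
      ∀ ε : ℝ, 0 < ε → ε ≤ 1 →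
        ∃ c : ℕ, ¬ (APSP c).RandInTimeO fun n => (n : ℝ) ^ (3 - ε) := by
  refine ⟨fun h ε hε _ => h ε hε, fun h ε hε => ?_⟩
  rcases le_or_gt ε 1 with hle | hlt
  · exact h ε hε hle
  · exact apspConjectureRand_restricted_one_lt ε hlt

/-! ## Link with the `RandTrulySubTime` vocabulary -/

/-- "`APSP c` is not randomised truly subcubic" (`FGProblem.RandTrulySubTime`, VVW ICM 2018, §2)
unfolds to the fixed-exponent randomised hypothesis
`∀ ε > 0, ¬ (APSP c).RandInTimeO (n ↦ n^{3-ε})`. [folklore] -/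
theorem not_randTrulySubTime_APSP_iff (c : ℕ) :
    ¬ (APSP c).RandTrulySubTime 3 ↔
      ∀ ε : ℝ, 0 < ε → ¬ (APSP c).RandInTimeO fun n => (n : ℝ) ^ (3 - ε) :=
  ⟨fun h ε hε hT => h ⟨ε, hε, hT⟩, fun h ⟨ε, hε, hT⟩ => h ε hε hT⟩

/-- Hence the randomised APSP hypothesis follows as soon as one weight exponent `c` makes
`APSP c` not randomised truly subcubic (then every `c' ≥ c` does, `APSP_randInTimeO_anti`).
[folklore] -/
theorem apspConjectureRand_of_not_randTrulySubTime {c : ℕ} (h : ¬ (APSP c).RandTrulySubTime 3) :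
    APSPConjectureRand :=
  fun ε hε => ⟨c, (not_randTrulySubTime_APSP_iff c).1 h ε hε⟩

end Literature.Computability.FineGrained
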